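import Literature.MathematicalPhysics.QuantumFieldTheory.Balaban1983to89.B9B8KnitClosenessOfSectors
import Literature.MathematicalPhysics.QuantumFieldTheory.Balaban1983to89.B9B8KnitHolderZeroOfGlob

/-!
# `Balaban1983to89.B9B8KnitTorusSocketBetaZero` — the (B)-line bond junction, file 8c: THE β = 0 EDITIONS of files 8b ∕ 5 — the Hölder binder of
# pub-ymgap's guarded socket at the torus datum DISCHARGED at `β = 0` by g6's file 8a (`holderAtIPer_zero_of_globAtIPer`), so that `SockB9P3Per … 0 len`
# follows from the per-background def-Y binder (8b) resp. the sector binder (5) ALONE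

statement-level skeleton of published theorems with citation tags; proofs where landed; nothing here is a claim about the
Yang–Mills mass gap

Sub-row G-B8-T2S (unit `lit-balaban-t2s-1`, gen 7), RULING #10 road (e).  File 8b (`B9B8KnitTorusGlobPackaging`) kept the Hölder binder
`HolderAtIPer … a_T C_β β len` as an INPUT of its socket theorem (only so as not to wait on file 8a's build); at `β = 0` that binder follows from `GlobAtIPer`
(8b's own output) by file 8a with `C_β = 2·(2B₀)`, the record's `Gop` being periodic (`gop_isPeriodic_opsAllZdPer`).  This file composes the three.
Print: [B8] (1.59) p. 86 (β-free reading, `β = 0`), Prop. 3 p. 87; [4] (3.40)–(3.42) p. 397, Thm 3.3 p. 399.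

WHAT IS PROVED (kernel, 0 sorry; theorems only, no `def`, no `… : Prop` fact, no `instance`).
* ★★★ `sockB9P3Per_torusIdx_of_defY₀` — file 8b's `sockB9P3Per_torusIdx_of_defY` WITHOUT the Hölder hypothesis, at `β = 0`, `C_β = 4B₀`.
* ★★★ `sockB9P3Per_torusIdx_of_sectors₀` — file 5's `sockB9P3Per_torusIdx_of_sectors` WITHOUT the Hölder hypothesis, at `β = 0`, `C_β = 4B₀` (`M_N(ℂ)`).

HONEST SCOPE.  Composition only; the def-Y ∕ sector binders stay DISPLAYED; `stub_PV3A` ∕ `B9P3PerAt` NOT discharged; count-neutral; nothing continuum ∕ ℝ⁴ ∕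
OS ∕ mass gap ∕ Clay — the Yang–Mills mass gap is NOT proved here or by these files.  NEW file; files 8a, 8b, 5 are used BY NAME, nothing landed is modified.
-/

noncomputable section

namespace Literature.MathematicalPhysics.QuantumFieldTheory.Balaban1983to89.B9B8KnitTorusSocketBetaZero

open scoped BigOperators
open Node00
open B7Prop1Explicit renaming Site → LSite
open B7Prop2Explicit (unitaryUnits)
open B6KLevelCensusIndexV1 (KIdx)
open B6GlobalChartV1 (PV)
open B8Ineq132 (InAk)
open B8LeafModelZd (ZdIdx)
open B8LeafModelZd3SockPer (SockB9P3Per)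
open B8Thm4TorusAt (torusLam)
open B8Thm2TorusMember (TorusMember torusIdx torusLamb)
open B9B8KnitBondTransfer (descBd liftBd)
open B9B8AveragingJunction (parKnitY)
open B8Thm2TorusLettersPerOfKnit (bgY)
open B9SupplySockB9P3ZdLetters (OpsZd deltaAOf)
open B9SupplySockB9P3ZdAllLettersZdPer (opsAllZdPer)
open B9Eq316AveragingTransposeZd (qQ betaTau)
open B9Eq316AveragingTransposeZdPrinted (QQZdP)
open B9B8KnitTorusGlobPackaging (binders_torusIdx_of_defY sockB9P3Per_torusIdx_of_defY gop_isPeriodic_opsAllZdPer)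
open B9B8KnitHolderZeroOfGlob (holderAtIPer_zero_of_globAtIPer)
open B9B8KnitClosenessOfSectors (defY_binder_of_sectors)
open T4TermwiseTorus (IsPeriodic)

variable {d ℓ : ℕ} {hd : 1 ≤ d + 1} {hL : Odd (ℓ + 1) ∧ 1 < ℓ + 1} {b₀ b₁ : ℝ}

section Generic

variable {𝔸 : Type} [CStarAlgebra 𝔸] [Nontrivial 𝔸] [FiniteDimensional ℝ 𝔸] (τ : 𝔸 →ₗ[ℂ] ℂ) (i : KIdx d ℓ hd hL b₀ b₁) {n : ℕ}

/-- ★★★ **[B8] (1.59) ON THE TORUS AT β = 0 FROM THE PER-BACKGROUND def-Y BINDER ALONE** — file 8b's `sockB9P3Per_torusIdx_of_defY` with its Hölder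
hypothesis discharged by file 8a: `SockB9P3Per P₀ L (max 1 (4B₀·max 1 q)) (2·max 0 (4B₀)·max 1 q) c_P 0 len η n {ℤ^{d+1}} torusLam torusLamb`.
[cite: Balaban1985RegularSpaces, (1.58)–(1.59) p.86, Prop. 3 p.87, p.77 («Ω_j = T_η»); Balaban1985BackgroundPropagators, Thm 3.3 p.399, Thm 3.11 p.416, (3.40)–(3.42) p.397] -/
theorem sockB9P3Per_torusIdx_of_defY₀ (hd2 : 2 ≤ d + 1) (hL1 : 1 ≤ ℓ + 1) (hτp : ∀ a : 𝔸, a ≠ 0 → 0 < (τ (star a * a)).re)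
    (hτt : ∀ a b : 𝔸, τ (a * b) = τ (b * a)) (hτs : ∀ a : 𝔸, τ (star a) = starRingEnd ℂ (τ a))
    {Cτ : ℝ} (hCτ : ∀ x y : 𝔸, |(τ (star x * y)).re| ≤ Cτ * ‖x‖ * ‖y‖)
    (hlev : ∀ z : SiteY i, levY i z = n) (hcf : i.cf = (((ℓ + 1 : ℕ) : ℝ)) ^ (n + 1)) {η : ℝ} (hη : 0 < η) {k : ℕ} (hk : 1 ≤ k)
    (hdvd : (ℓ + 1) ^ n ∣ (PV d ℓ i.m i.K hd hL).sitesPerDir 0) (ops₀ : ℝ → ZdIdx (d + 1) (ℓ + 1) → ℕ → OpsZd (d + 1) 𝔸) {M : ℝ} (hM1 : 1 ≤ M)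
    (parS : SiteParY 𝔸 i) (parB : BondParY 𝔸 i) (Gp : SiteOpY 𝔸 i) {B₀ ε aT : ℝ} (hB₀ : 0 < B₀) (hε : 0 ≤ ε) (hεB : 2 * ε * B₀ ≤ 1)
    (hY : ∀ (α₀ : ℝ) (U₀ : LSite (d + 1) → Fin (d + 1) → 𝔸ˣ), (∀ x κ, U₀ x κ ∈ unitaryUnits 𝔸) →
      IsPeriodic ((PV d ℓ i.m i.K hd hL).sitesPerDir 0) U₀ → 0 < α₀ → α₀ ≤ aT →
      InAk (ℓ + 1) n η α₀ (fun _ => (Set.univ : Set (LSite (d + 1)))) U₀ →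
        IsUnit (deltaAY i parS parB Gp (bgY i U₀)) ∧
        (∀ F, wNormBY i (-1) (GAY i parS parB Gp (bgY i U₀) F) ≤ B₀ * wNormBY i (-3) F) ∧
        (∀ F ν, wNormBY i (-2) (cdB i (bgY i U₀) ν (GAY i parS parB Gp (bgY i U₀) F)) ≤ B₀ * wNormBY i (-3) F) ∧
        (∀ F, wNormBY i (-3) (lapB i (bgY i U₀) (GAY i parS parB Gp (bgY i U₀) F)) ≤ B₀ * wNormBY i (-3) F) ∧
        (∀ a : FBondY i → 𝔸, (∀ b, IsSelfAdjoint (a b)) →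
          wNormBY i (-3) (deltaAY i parS parB Gp (bgY i U₀) a - ((i.cf * η) ^ 2 : ℝ) •
            descBd i (deltaAOf η (opsAllZdPer τ (ℓ + 1) ((PV d ℓ i.m i.K hd hL).sitesPerDir 0) (fun m => torusLamb (d := d + 1) m) ops₀ M
              (torusIdx (d := d + 1) hL1 ⟨η, hη, k, hk⟩) n) U₀ (liftBd i a))) ≤ ε * wNormBY i (-1) a)) (len : LSite (d + 1) → ℝ) :
    SockB9P3Per (𝔸 := 𝔸) ((PV d ℓ i.m i.K hd hL).sitesPerDir 0) (ℓ + 1)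
      (max 1 (2 * (2 * B₀) * max 1 (qQ (d + 1) (ℓ + 1) Cτ (betaTau τ) 0)))
      (2 * max 0 (2 * (2 * B₀)) * max 1 (qQ (d + 1) (ℓ + 1) Cτ (betaTau τ) 0))
      (min (1 / 16) (min aT (min aT (1 / (2 * (2 * B₀) * (14 * ((d + 1 - 1 : ℕ) : ℝ)) * M + 1)))))
      0 len η n (fun _ => (Set.univ : Set (LSite (d + 1)))) (fun m => torusLam (d := d + 1) m) (fun m => torusLamb (d := d + 1) m) := by
  haveI : NeZero ((PV d ℓ i.m i.K hd hL).sitesPerDir 0) := ⟨(PV d ℓ i.m i.K hd hL).sitesPerDir_ne_zero 0⟩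
  obtain ⟨-, hglob⟩ := binders_torusIdx_of_defY τ i hd2 hL1 hτp hτt hτs hlev hcf hη hk hdvd ops₀ M parS parB Gp hB₀ hε hεB hY
  have hhol := holderAtIPer_zero_of_globAtIPer hd2 hL1 (i := torusIdx (d := d + 1) hL1 ⟨η, hη, k, hk⟩) (fun _ => rfl) (by positivity)
    (fun U₀ J _ _ => gop_isPeriodic_opsAllZdPer τ _ _ ops₀ M _ n U₀ J) len hglob
  exact sockB9P3Per_torusIdx_of_defY τ i hd2 hL1 hτp hτt hτs hCτ hlev hcf hη hk hdvd ops₀ hM1 parS parB Gp hB₀ hε hεB hY hhol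

end Generic

section Matrix

open scoped Matrix Matrix.Norms.L2Operator

variable {N : ℕ} [NeZero N] (i : KIdx d ℓ hd hL b₀ b₁) {n : ℕ}

/-- ★★★ **[B8] (1.59) ON THE TORUS AT β = 0 FROM THE SECTOR BINDER ALONE** (`M_N(ℂ)`, `τ = tr`): file 5's `sockB9P3Per_torusIdx_of_sectors` with the Hölder
hypothesis discharged by file 8a (`C_β = 4B₀`).  The displayed inputs left: def-Y's Thm-3.3 ∕ 3.11 letter data, def-Y's curvature smallness `κ`, the averaging
closeness `ε_Q` — under `2(κ + 14d·M·a_T + ε_Q)B₀ ≤ 1`.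
[cite: Balaban1985RegularSpaces, (1.58)–(1.59) p.86, Prop. 3 p.87, p.77; Balaban1985BackgroundPropagators, Thm 3.3 p.399, (3.26) p.395, (3.40)–(3.42) p.397, (3.69) p.404] -/
theorem sockB9P3Per_torusIdx_of_sectors₀ (hd2 : 2 ≤ d + 1) (hL1 : 1 ≤ ℓ + 1)
    (τ : Matrix (Fin N) (Fin N) ℂ →ₗ[ℂ] ℂ) (hτ : ∀ a, τ a = Matrix.trace a) (hτt : ∀ a b, τ (a * b) = τ (b * a))
    {Cτ : ℝ} (hCτ : ∀ x y : Matrix (Fin N) (Fin N) ℂ, |(τ (star x * y)).re| ≤ Cτ * ‖x‖ * ‖y‖)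
    (hlev : ∀ z : SiteY i, levY i z = n) (hcf : i.cf = (((ℓ + 1 : ℕ) : ℝ)) ^ (n + 1)) {η : ℝ} (hη : 0 < η) {k : ℕ} (hk : 1 ≤ k)
    (hdvd : (ℓ + 1) ^ n ∣ (PV d ℓ i.m i.K hd hL).sitesPerDir 0)
    (ops₀ : ℝ → ZdIdx (d + 1) (ℓ + 1) → ℕ →
      (letI : CStarAlgebra (Matrix (Fin N) (Fin N) ℂ) := {}; OpsZd (d + 1) (Matrix (Fin N) (Fin N) ℂ)))
    {M : ℝ} (hM1 : 1 ≤ M) (parB : BondParY (Matrix (Fin N) (Fin N) ℂ) i) {B₀ κ εQ aT : ℝ} (hB₀ : 0 < B₀) (hκ : 0 ≤ κ) (hεQ : 0 ≤ εQ)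
    (haT : 0 ≤ aT) (hεB : 2 * (κ + 14 * d * M * aT + εQ) * B₀ ≤ 1)
    (hY : letI : CStarAlgebra (Matrix (Fin N) (Fin N) ℂ) := {}
      ∀ (α₀ : ℝ) (U₀ : LSite (d + 1) → Fin (d + 1) → (Matrix (Fin N) (Fin N) ℂ)ˣ),
      (∀ x κ, U₀ x κ ∈ B7Prop2Explicit.unitaryUnits (Matrix (Fin N) (Fin N) ℂ)) →
      IsPeriodic ((PV d ℓ i.m i.K hd hL).sitesPerDir 0) U₀ → 0 < α₀ → α₀ ≤ aT →
      InAk (ℓ + 1) n η α₀ (fun _ => (Set.univ : Set (LSite (d + 1)))) U₀ →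
        IsUnit (deltaAY i (parKnitY i) parB (GpY i (parKnitY i)) (bgY i U₀)) ∧
        (∀ F, wNormBY i (-1) (GAY i (parKnitY i) parB (GpY i (parKnitY i)) (bgY i U₀) F) ≤ B₀ * wNormBY i (-3) F) ∧
        (∀ F ν, wNormBY i (-2) (cdB i (bgY i U₀) ν (GAY i (parKnitY i) parB (GpY i (parKnitY i)) (bgY i U₀) F)) ≤ B₀ * wNormBY i (-3) F) ∧
        (∀ F, wNormBY i (-3) (lapB i (bgY i U₀) (GAY i (parKnitY i) parB (GpY i (parKnitY i)) (bgY i U₀) F)) ≤ B₀ * wNormBY i (-3) F) ∧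
        IsUnit (deltaPrimeAY i (parKnitY i) (bgY i U₀)) ∧ IsUnit (XY i (parKnitY i) (GpY i (parKnitY i)) (bgY i U₀)) ∧
        (∀ z w : SiteY i, parKnitY i (bgY i U₀) z w ∈ B7Prop2Explicit.unitaryUnits (Matrix (Fin N) (Fin N) ℂ)) ∧
        (∀ a : FBondY i → Matrix (Fin N) (Fin N) ℂ, (∀ b, IsSelfAdjoint (a b)) →
          wNormBY i (-3) (coCurlY i (bgY i U₀) (jordanY i (bgY i U₀) (curlY i (bgY i U₀) a) - curlY i (bgY i U₀) a) + curv2Y i (bgY i U₀) a) ≤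
            κ * wNormBY i (-1) a) ∧
        (∀ a : FBondY i → Matrix (Fin N) (Fin N) ℂ, (∀ b, IsSelfAdjoint (a b)) →
          wNormBY i (-3) (QsY i parB (bgY i U₀) (aY i (QY i parB (bgY i U₀) a)) - ((i.cf * η) ^ 2 : ℝ) •
              descBd i (QQZdP τ (ℓ + 1) (fun m => torusLamb (d := d + 1) m) (torusIdx (d := d + 1) hL1 ⟨η, hη, k, hk⟩) n U₀ (liftBd i a))) ≤
            εQ * wNormBY i (-1) a))
    (len : LSite (d + 1) → ℝ) :
    letI : CStarAlgebra (Matrix (Fin N) (Fin N) ℂ) := {}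
    SockB9P3Per (𝔸 := Matrix (Fin N) (Fin N) ℂ) ((PV d ℓ i.m i.K hd hL).sitesPerDir 0) (ℓ + 1)
      (max 1 (2 * (2 * B₀) * max 1 (qQ (d + 1) (ℓ + 1) Cτ (betaTau τ) 0)))
      (2 * max 0 (2 * (2 * B₀)) * max 1 (qQ (d + 1) (ℓ + 1) Cτ (betaTau τ) 0))
      (min (1 / 16) (min aT (min aT (1 / (2 * (2 * B₀) * (14 * ((d + 1 - 1 : ℕ) : ℝ)) * M + 1)))))
      0 len η n (fun _ => (Set.univ : Set (LSite (d + 1)))) (fun m => torusLam (d := d + 1) m) (fun m => torusLamb (d := d + 1) m) := by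
  letI : CStarAlgebra (Matrix (Fin N) (Fin N) ℂ) := {}
  have hτs : ∀ a : Matrix (Fin N) (Fin N) ℂ, τ (star a) = starRingEnd ℂ (τ a) := B9B8KnitLandauProjection.trace_hermitian τ hτ
  have hτp : ∀ a : Matrix (Fin N) (Fin N) ℂ, a ≠ 0 → 0 < (τ (star a * a)).re := B9B8KnitLandauProjection.trace_faithful τ hτ
  have hM0 : 0 ≤ M := zero_le_one.trans hM1
  have hε : 0 ≤ κ + 14 * d * M * aT + εQ := by positivity
  exact sockB9P3Per_torusIdx_of_defY₀ τ i hd2 hL1 hτp hτt hτs hCτ hlev hcf hη hk hdvd ops₀ hM1 (parKnitY i) parB (GpY i (parKnitY i)) hB₀ hε hεB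
    (defY_binder_of_sectors i hL1 τ hτ hlev hcf hη hk ops₀ hM1 parB hY) len

end Matrix

end Literature.MathematicalPhysics.QuantumFieldTheory.Balaban1983to89.B9B8KnitTorusSocketBetaZero
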